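import Summits.BirchSwinnertonDyer.BirchSwinnertonDyer.Theorems.GenusKolyvaginAtTwoPowDvdShaCardAtTwoPosTEigenIndexTwoRegular
import Summits.BirchSwinnertonDyer.BirchSwinnertonDyer.Theorems.GenusKolyvaginAtTwoPowDvdShaCardAtTwoRTRegularFrameAtTwo
import Summits.BirchSwinnertonDyer.BirchSwinnertonDyer.Theorems.GenusKolyvaginAtTwoGenusPrimitiveSupplyAtTwoConjugationTypeAtTwo
import HarnessLib

/-!
# Route `GenusKolyvaginAtTwo`, crux L⁺_T `PowDvdShaCardAtTwoPosT` (stmt-BirchSwinnertonDyer-23379), road «E4⁺» (LEAD R10), socket hK⁺ IN THE KS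
# ASSEMBLY'S CURRENCY: at a Zhang–Kolyvagin prime of index `≥ L` the regular clause is just «some Frobenius above `ℓ` moves a point of `E[2]`»

Seat `bsd-line-gk2-p4` g24 (WIDTH-5 attach, cell `bsd-f1-sign2`), `--supports stmt-BirchSwinnertonDyer-23379 --as helper`.
THEOREMS ONLY (no definition, no named fact, no `sorry`).  BSD is NOT proved by any of this; L⁺_T / Q4_T are NOT claimed; nothing is closed.

WHAT.  The companion `…PosTEigenIndexTwoRegular` proves the eigen index law `(⨅_{v∋ℓ} torsionLocalKer_v).relIndex (C ⊓ H¹[2]) ∣ 2` at a prime `ℓ`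
carrying an arithmetic Frobenius `h` that is complex conjugation on `K`, an involution on `E[2^L]` and moves a point of `E[2]`.  At a
Zhang–Kolyvagin prime at `2` of index `≥ L` (`ℓ ∤ 2 N d_K`, `(ℓ)` inert, `2^L ∣ ℓ + 1`, `2^L ∣ a_ℓ`) — the primes of every KS assembly — all of
that clause except «moves a point of `E[2]`» is AUTOMATIC (§1), so the socket `hK` of gk2-p2 g19's `exists_recordLevel_avoiding_of_deepSwap` is
discharged over any prime class yielding gk2-p2 g22's (β″-mirror) witness clause
`TRANSP ℓ := ∃ v 𝔓 (h : Γ_ℚ), ℓ ∈ v ∧ 𝔓 ∈ v.primesAbove ∧ IsArithFrobAt (𝓞 ℚ) h 𝔓 ∧ ∃ u : geomTorsion W 2, h • u ≠ u` (spelled EXACTLY as in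
gk2-p2 g22's `…PosTTranspositionFrame` / `ctOrthogonalAtTwo_of_frame_transposition`) (§2), in particular over LEAD R10′'s margin class
`G q := L + k ≤ Zhang2014.kolyvaginIndex W 2 q ∧ TRANSP q`; and on `Δ < 0` the level-`2` Gross socket of p727553 is recovered WITHOUT its
surjectivity hypothesis (§3).
* §1 `relIndex_iInf_torsionLocalKer_inf_torsionBy_two_dvd_two_of_frob_smul_ne` — move the Frobenius to the prime `𝔓_w ∩ \bar ℤ` below the
  completion prime of `w = (ℓ)` (`exists_isArithFrobAt_conj_of_mem_primesAbove`; conjugation keeps a moved `2`-torsion point); it is no restriction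
  from `Γ_K` (`ℓ` inert: JET `not_mem_range_absGaloisRestrict_of_isArithFrobAt`), nor is a complex conjugation `c₀` (`K` totally complex), so
  `c₀⁻¹ h = res g` (index `2`) and `h = c₀` on every embedded `K` (`absGaloisRestrict_smul_apply_eq`); `h² = res F` with `F` in the decomposition
  group of `𝔓_w`, which fixes `E(K̄)[2^L]` (JET brick C `smul_torsion_eq_self_of_mem_decompositionSubgroup`: `Frob_λ ≡ a_ℓ Frob_ℓ − ℓ ≡ 1 (mod 2^L)`);
* §2 plug forms VERBATIM in the assembly's currency: `hK_socket_of_frob_smul_ne` (generic `G`), `hK_socket_margin_of_frob_smul_ne` (R10's margin class),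
  `relIndex_iInf_torsionLocalKer_closure_dvd_two_of_frob_smul_ne` (the weak swap loop's `∀ s ⊆ R` binder),
  `relIndex_iInf_torsionLocalKer_closure_sup_zmultiples_dvd_two_of_frob_smul_ne` (the KS clause's `⟨u⟩ ⊔ ⟨x⟩`);
* §3 `hK_socket_of_frobEqFrobInfty_two_of_Δ_neg` — consistency: on `Δ < 0`, (3.2) at level `2` moves a `2`-torsion point
  (`GenusKolySign.exists_twoTorsion_frob_smul_ne_of_frobEqFrobInfty_of_Δ_neg`), so p727553's `hK_socket_of_frobEqFrobInfty_two` holds with its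
  hypothesis `ρ_{E,2^L}` onto DROPPED.

HONEST FRAMING.  Plumbing over the companion file and JET's decomposition-group bricks; closes nothing; BSD is not proved.

References: [McCallumLMS1991] §3 (3), Cor. 3.2, §5 proof of Prop. 5.2, Lemma 5.3; [GrossLMS1991] §3 (3.1)–(3.3), §4, §9 Prop. 9.6;
[WZhang2014] Notations (xii); [NeukirchANT1999] Ch. I §9 Prop. (9.4); [SilvermanAEC2009] III.1.
-/

set_option autoImplicit false
-- `Summit.<P>.<Sub>` repeats `BirchSwinnertonDyer` by the tree's layout convention (D-0017)
set_option linter.dupNamespace false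

noncomputable section

open scoped Classical

namespace Summit.BirchSwinnertonDyer.BirchSwinnertonDyer.Theorems.GenusExact.PlusDescent

open WeierstrassCurve NumberField IsDedekindDomain Field
open Literature.NumberTheory.GaloisRepresentations Literature.NumberTheory.EllipticCurves
open Summit.BirchSwinnertonDyer.Rank1Residual.JET.GlobalDuality
  (smul_torsion_eq_self_of_mem_decompositionSubgroup not_mem_range_absGaloisRestrict_of_isArithFrobAt)
open Summit.BirchSwinnertonDyer.BirchSwinnertonDyer.Theorems.GenusKolySign (exists_twoTorsion_frob_smul_ne_of_frobEqFrobInfty_of_Δ_neg)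

variable (W : WeierstrassCurve ℚ) [W.IsElliptic] {K : Type} [Field K] [NumberField K]

/-! ## §1 At a Zhang–Kolyvagin prime of index `≥ L` the regular clause is «some Frobenius above `ℓ` moves a point of `E[2]`» -/

/-- **hK⁺ at a Zhang–Kolyvagin prime, in the (β″-mirror) currency.**  `K` imaginary quadratic, `τ ≠ 1`, `1 ≤ L ≤ M(ℓ)` for a Zhang–Kolyvagin
prime `ℓ` at `2` (`ℓ ∤ 2 N d_K`, `(ℓ)` inert, `2^L ∣ ℓ + 1`, `2^L ∣ a_ℓ`), and an arithmetic Frobenius at SOME prime of `\bar ℤ` above `ℓ` MOVING a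
point of `E(ℚ̄)[2]` (gk2-p2 g22's TRANSP clause, spelled as in `…PosTTranspositionFrame`; level-free).
Then for every `τ`-eigen subgroup `C` of Selmer classes in `H¹(K, E[2^L])`: **`(⨅_{v∋ℓ} torsionLocalKer_v).relIndex (C ⊓ H¹[2]) ∣ 2`**.  The rest of
the companion's regular clause is AUTOMATIC here: move the Frobenius to the prime `𝔓_w ∩ \bar ℤ` under the completion prime of `w = (ℓ)`
(`exists_isArithFrobAt_conj_of_mem_primesAbove`; conjugation keeps a moved `2`-torsion point); it is not a restriction from `Γ_K` (`ℓ` inert: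
`not_mem_range_absGaloisRestrict_of_isArithFrobAt`), neither is any complex conjugation `c₀` (`K` totally complex), so `c₀⁻¹ h = res g` (index `2`) and
`h = c₀` on every embedded `K` (`absGaloisRestrict_smul_apply_eq`); and `h² = res F` with `F` in the decomposition group of `𝔓_w`, which fixes
`E(K̄)[2^L]` at index `≥ L` (JET `smul_torsion_eq_self_of_mem_decompositionSubgroup`: `Frob_λ ≡ Frob_ℓ² ≡ a_ℓ Frob_ℓ − ℓ ≡ 1 (mod 2^L)`).
[cite: McCallumLMS1991, §5 proof of Prop. 5.2, Lemma 5.3] [cite: GrossLMS1991, §3 (3.1)–(3.3), §4] [cite: WZhang2014, Notations (xii)] -/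
theorem relIndex_iInf_torsionLocalKer_inf_torsionBy_two_dvd_two_of_frob_smul_ne [W.IsGloballyMinimal]
    (hK : IsImaginaryQuadratic K) {τ : K ≃ₐ[ℚ] K} (hτ : τ ≠ 1) {L : ℕ} (hL : 1 ≤ L) {ℓ : ℕ}
    (hKol : Zhang2014.IsKolyvaginPrime (W.conductorNorm ℤ) W K 2 ℓ) (hidx : L ≤ Zhang2014.kolyvaginIndex W 2 ℓ)
    (hfrob : ∃ (v : HeightOneSpectrum (𝓞 ℚ)) (𝔓 : Ideal (absIntegers (𝓞 ℚ) ℚ)) (h : absoluteGaloisGroup ℚ),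
      (ℓ : 𝓞 ℚ) ∈ v.asIdeal ∧ 𝔓 ∈ v.primesAbove ∧ IsArithFrobAt (𝓞 ℚ) h 𝔓 ∧ ∃ u : geomTorsion W 2, h • u ≠ u)
    {ε : ℤ} (hε : ε = 1 ∨ ε = -1)
    (C : AddSubgroup (galH1Torsion (W.baseChange K) ((2 ^ L : ℕ) : ℤ)))
    (hC : ∀ c ∈ C, c ∈ selmerGroup (W.baseChange K) ((2 ^ L : ℕ) : ℤ) ∧
      conjAct W τ ((2 ^ L : ℕ) : ℤ) c = ε • c) :
    (⨅ (v : HeightOneSpectrum (𝓞 K)) (_ : (ℓ : 𝓞 K) ∈ v.asIdeal),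
        (W.baseChange K).torsionLocalKer (v.adicCompletion K) ((2 ^ L : ℕ) : ℤ)).relIndex
      (C ⊓ AddSubgroup.torsionBy (galH1Torsion (W.baseChange K) ((2 ^ L : ℕ) : ℤ)) (2 : ℤ)) ∣ 2 := by
  haveI : Fact ℓ.Prime := ⟨hKol.1⟩
  haveI : Fact (Nat.Prime 2) := ⟨Nat.prime_two⟩
  haveI : Algebra.IsQuadraticExtension ℚ K := ⟨hK.1⟩
  haveI : IsTotallyComplex K := hK.2
  have hℓ : ℓ.Prime := hKol.1
  have hℓP : (Ideal.span {(ℓ : 𝓞 K)}).IsPrime := hKol.2.2.2.2.1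
  obtain ⟨v, 𝔓₀, h₀, hℓv, h𝔓₀, hh₀, u₀, hu₀⟩ := hfrob
  -- ### the place `w = (ℓ)` of `K`, its completion prime `𝔔`, and `𝔓' = 𝔔 ∩ \bar ℤ`
  set w : HeightOneSpectrum (𝓞 K) := ⟨Ideal.span {(ℓ : 𝓞 K)}, hℓP, by
    rw [Ne, Ideal.span_singleton_eq_bot]; exact_mod_cast hℓ.ne_zero⟩ with hwdef
  have hℓw : (ℓ : 𝓞 K) ∈ w.asIdeal := Ideal.mem_span_singleton_self _
  have hwv' : w.under (𝓞 ℚ) = v := by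
    apply HeightOneSpectrum.eq_of_natCast_mem_rat hℓ _ hℓv
    rw [HeightOneSpectrum.under_asIdeal, Ideal.under_def, Ideal.mem_comap, map_natCast]
    exact hℓw
  have hwv : w.asIdeal.under (𝓞 ℚ) = v.asIdeal := by rw [← hwv']; rfl
  set 𝔔 := adicCompletionPrime K w with h𝔔def
  have h𝔔 : 𝔔 ∈ w.primesAbove := adicCompletionPrime_mem_primesAbove K w
  set 𝔓' := 𝔔.comap (absIntegersMap ℚ K) with h𝔓'def
  have h𝔓' : 𝔓' ∈ v.primesAbove := comap_absIntegersMap_mem_primesAbove hwv h𝔔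
  haveI : 𝔓'.IsPrime := h𝔓'.1
  -- ### move the Frobenius to `𝔓'`; it still moves a `2`-torsion point
  obtain ⟨γ, -, hh⟩ := HeightOneSpectrum.exists_isArithFrobAt_conj_of_mem_primesAbove_holds h𝔓₀ h𝔓' hh₀
  set h : absoluteGaloisGroup ℚ := γ * h₀ * γ⁻¹ with hhdef
  have hu : h • (γ • u₀) ≠ γ • u₀ := by
    rw [hhdef, mul_smul, mul_smul, inv_smul_smul]
    exact fun e ↦ hu₀ (MulAction.injective γ e)
  -- ### `h ∉ res Γ_K` (inert), `c₀ ∉ res Γ_K` (totally complex) ⟹ `c₀⁻¹ h = res g`, so `h = c₀` on every embedded `K`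
  have hHi : (absGaloisRestrict ℚ K).range.index = 2 := (index_range_absGaloisRestrict_eq_finrank ℚ K).trans hK.1
  have hhH : h ∉ (absGaloisRestrict ℚ K).range :=
    not_mem_range_absGaloisRestrict_of_isArithFrobAt K hK.1 hℓ hℓP hℓw h𝔔 hℓv h𝔓' hh
  obtain ⟨c₀, hc₀⟩ := exists_isComplexConjugation (Rat.castHom ℝ)
  have hcH : c₀ ∉ (absGaloisRestrict ℚ K).range := fun hmem ↦
    hc₀.not_mem_range_absGaloisRestrict (L := K) IsTotallyComplex.isComplex hmem
  obtain ⟨g, hg⟩ : c₀⁻¹ * h ∈ (absGaloisRestrict ℚ K).range := by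
    rw [Subgroup.mul_mem_iff_of_index_two hHi, Subgroup.inv_mem_iff]
    exact iff_of_false hcH hhH
  have hhg : h = c₀ * absGaloisRestrict ℚ K g := by
    rw [show absGaloisRestrict ℚ K g = c₀⁻¹ * h from hg, mul_inv_cancel_left]
  have hKx : ∀ (e : K →ₐ[ℚ] AlgebraicClosure ℚ) (z : K), h • e z = c₀ • e z := fun e z ↦ by
    rw [hhg, mul_smul, absGaloisRestrict_smul_apply_eq]
  -- ### `h² = res F` with `F ∈ G_𝔔`, which fixes `E(K̄)[2^L]` at index `≥ L`; so `h² = 1` on `E(ℚ̄)[2^L]`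
  obtain ⟨F, hF⟩ : h * h ∈ (absGaloisRestrict ℚ K).range := Subgroup.mul_self_mem_of_index_two hHi h
  have hFD : F ∈ 𝔔.decompositionSubgroup (absoluteGaloisGroup K) := by
    rw [← comap_decompositionSubgroup_comap_absIntegersMap ℚ K 𝔔, Subgroup.mem_comap]
    change absGaloisRestrict ℚ K F ∈ 𝔓'.decompositionSubgroup (absoluteGaloisGroup ℚ)
    rw [show absGaloisRestrict ℚ K F = h * h from hF]
    exact Subgroup.mul_mem _ hh.mem_stabilizer hh.mem_stabilizer
  have hhh : ∀ X : geomTorsion W ((2 ^ L : ℕ) : ℤ), h • h • X = X := fun X ↦ by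
    apply (RatClosure.torsionEquiv (K := K) W ((2 ^ L : ℕ) : ℤ)).injective
    rw [← mul_smul, ← show absGaloisRestrict ℚ K F = h * h from hF, RatClosure.torsionEquiv_smul,
      smul_torsion_eq_self_of_mem_decompositionSubgroup W K hK hKol hidx w hℓw h𝔔 hFD]
  exact relIndex_iInf_torsionLocalKer_inf_torsionBy_two_dvd_two_regular W hK hτ hL hKol.2.2.2.1 hKol.2.2.1
    (hasGoodReductionAtPrime_of_not_dvd_conductorNorm W hKol.2.1)
    ⟨v, 𝔓', h, c₀, hℓv, h𝔓', hh, hc₀, hhh, ⟨γ • u₀, hu⟩, hKx⟩ hε C hC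

/-! ## §2 Plug forms in the KS assembly's currency (the socket `hK` of `exists_recordLevel_avoiding_of_deepSwap`) -/

/-- **The KS assembly's socket `hK`, discharged at REGULAR primes** for every extra prime predicate `G` that yields «some arithmetic Frobenius above
`ℓ` moves a point of `E[2]`» at the admissible (Zhang–Kolyvagin, index `≥ L`) primes: VERBATIM the binder `hK` of gk2-p2 g19's
`PlusDescent.exists_recordLevel_avoiding_of_deepSwap` — p727553's `hK_socket_of_frobEqFrobInfty` with `(hΔ : W.Δ < 0)` deleted and Gross's (3.2)
replaced by the regular clause; no sign of `Δ` is assumed. [cite: McCallumLMS1991, §5 proof of Prop. 5.2] [cite: GrossLMS1991, §3 (3.1)–(3.3), §9 Prop. 9.6] -/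
theorem hK_socket_of_frob_smul_ne [W.IsGloballyMinimal] (hK : IsImaginaryQuadratic K) {τ : K ≃ₐ[ℚ] K} (hτ : τ ≠ 1)
    {L : ℕ} (hL : 1 ≤ L) (r : ℕ) (G : ℕ → Prop)
    (hG : ∀ ℓ : ℕ, Zhang2014.IsKolyvaginPrime (W.conductorNorm ℤ) W K 2 ℓ → L ≤ Zhang2014.kolyvaginIndex W 2 ℓ → G ℓ →
      ∃ (v : HeightOneSpectrum (𝓞 ℚ)) (𝔓 : Ideal (absIntegers (𝓞 ℚ) ℚ)) (h : absoluteGaloisGroup ℚ),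
        (ℓ : 𝓞 ℚ) ∈ v.asIdeal ∧ 𝔓 ∈ v.primesAbove ∧ IsArithFrobAt (𝓞 ℚ) h 𝔓 ∧ ∃ u : geomTorsion W 2, h • u ≠ u) :
    ∀ ℓ : ℕ, (Zhang2014.IsKolyvaginPrime (W.conductorNorm ℤ) W K 2 ℓ ∧ L ≤ Zhang2014.kolyvaginIndex W 2 ℓ) ∧ G ℓ →
      ∀ C : AddSubgroup (galH1Torsion (W.baseChange K) ((2 ^ L : ℕ) : ℤ)),
      (∀ c ∈ C, c ∈ selmerGroup (W.baseChange K) ((2 ^ L : ℕ) : ℤ) ∧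
        conjAct W τ ((2 ^ L : ℕ) : ℤ) c = (-W.rootNumber * (-1) ^ r) • c) →
      (⨅ (v : HeightOneSpectrum (𝓞 K)) (_ : ((ℓ : ℕ) : 𝓞 K) ∈ v.asIdeal),
          (W.baseChange K).torsionLocalKer (v.adicCompletion K) ((2 ^ L : ℕ) : ℤ)).relIndex
        (C ⊓ AddSubgroup.torsionBy (galH1Torsion (W.baseChange K) ((2 ^ L : ℕ) : ℤ)) (2 : ℤ)) ∣ 2 := by
  intro ℓ hℓ C hC
  exact relIndex_iInf_torsionLocalKer_inf_torsionBy_two_dvd_two_of_frob_smul_ne W hK hτ hL hℓ.1.1 hℓ.1.2 (hG ℓ hℓ.1.1 hℓ.1.2 hℓ.2)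
    (neg_rootNumber_mul_neg_one_pow_eq_or W r) C hC

/-- **`hK` for the regular margin-`k` predicate** `G ℓ := L + k ≤ index ℓ ∧ «some arithmetic Frobenius above ℓ moves a point of E[2]»` (LEAD R10 §1:
`Xp = Xm := fun ℓ ↦ L + 1 ≤ kolyvaginIndex W 2 ℓ ∧ REG ℓ`, margin `k = 1`; the regular clause is level-free, so nothing descends).
[cite: McCallumLMS1991, §5 proof of Prop. 5.2] [cite: GrossLMS1991, §3 (3.1)–(3.3)] -/
theorem hK_socket_margin_of_frob_smul_ne [W.IsGloballyMinimal] (hK : IsImaginaryQuadratic K) {τ : K ≃ₐ[ℚ] K} (hτ : τ ≠ 1)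
    {L : ℕ} (hL : 1 ≤ L) (r k : ℕ) :
    ∀ ℓ : ℕ, (Zhang2014.IsKolyvaginPrime (W.conductorNorm ℤ) W K 2 ℓ ∧ L ≤ Zhang2014.kolyvaginIndex W 2 ℓ) ∧
        (L + k ≤ Zhang2014.kolyvaginIndex W 2 ℓ ∧
          ∃ (v : HeightOneSpectrum (𝓞 ℚ)) (𝔓 : Ideal (absIntegers (𝓞 ℚ) ℚ)) (h : absoluteGaloisGroup ℚ),
            (ℓ : 𝓞 ℚ) ∈ v.asIdeal ∧ 𝔓 ∈ v.primesAbove ∧ IsArithFrobAt (𝓞 ℚ) h 𝔓 ∧ ∃ u : geomTorsion W 2, h • u ≠ u) →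
      ∀ C : AddSubgroup (galH1Torsion (W.baseChange K) ((2 ^ L : ℕ) : ℤ)),
      (∀ c ∈ C, c ∈ selmerGroup (W.baseChange K) ((2 ^ L : ℕ) : ℤ) ∧
        conjAct W τ ((2 ^ L : ℕ) : ℤ) c = (-W.rootNumber * (-1) ^ r) • c) →
      (⨅ (v : HeightOneSpectrum (𝓞 K)) (_ : ((ℓ : ℕ) : 𝓞 K) ∈ v.asIdeal),
          (W.baseChange K).torsionLocalKer (v.adicCompletion K) ((2 ^ L : ℕ) : ℤ)).relIndex
        (C ⊓ AddSubgroup.torsionBy (galH1Torsion (W.baseChange K) ((2 ^ L : ℕ) : ℤ)) (2 : ℤ)) ∣ 2 :=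
  hK_socket_of_frob_smul_ne W hK hτ hL r _ fun _ _ _ hGℓ ↦ hGℓ.2

/-- **`hK` for the weak swap loop, VERBATIM SHAPE, at a regular Zhang–Kolyvagin prime** (p723289's `…_closure_dvd_two_of_isKolyvaginPrime` with
`Δ < 0` deleted and (3.2) replaced by the moved-`2`-torsion clause): for `R` any subgroup of `ε`-eigen SELMER classes and every finite `s ⊆ R`,
**`(⨅_{v∋ℓ} torsionLocalKer_v).relIndex (closure s ⊓ V[2]) ∣ 2`**. [cite: McCallumLMS1991, §5 proof of Prop. 5.2] [cite: WZhang2014, Notations (xii)] -/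
theorem relIndex_iInf_torsionLocalKer_closure_dvd_two_of_frob_smul_ne [W.IsGloballyMinimal]
    (hK : IsImaginaryQuadratic K) {τ : K ≃ₐ[ℚ] K} (hτ : τ ≠ 1) {L : ℕ} (hL : 1 ≤ L) {ℓ : ℕ}
    (hKol : Zhang2014.IsKolyvaginPrime (W.conductorNorm ℤ) W K 2 ℓ) (hidx : L ≤ Zhang2014.kolyvaginIndex W 2 ℓ)
    (hfrob : ∃ (v : HeightOneSpectrum (𝓞 ℚ)) (𝔓 : Ideal (absIntegers (𝓞 ℚ) ℚ)) (h : absoluteGaloisGroup ℚ),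
      (ℓ : 𝓞 ℚ) ∈ v.asIdeal ∧ 𝔓 ∈ v.primesAbove ∧ IsArithFrobAt (𝓞 ℚ) h 𝔓 ∧ ∃ u : geomTorsion W 2, h • u ≠ u)
    {ε : ℤ} (hε : ε = 1 ∨ ε = -1) (R : AddSubgroup (galH1Torsion (W.baseChange K) ((2 ^ L : ℕ) : ℤ)))
    (hR : ∀ c ∈ R, c ∈ selmerGroup (W.baseChange K) ((2 ^ L : ℕ) : ℤ) ∧ conjAct W τ ((2 ^ L : ℕ) : ℤ) c = ε • c)
    (s : Finset (galH1Torsion (W.baseChange K) ((2 ^ L : ℕ) : ℤ)))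
    (hs : (↑s : Set (galH1Torsion (W.baseChange K) ((2 ^ L : ℕ) : ℤ))) ⊆ R) :
    (⨅ (v : HeightOneSpectrum (𝓞 K)) (_ : (ℓ : 𝓞 K) ∈ v.asIdeal),
        (W.baseChange K).torsionLocalKer (v.adicCompletion K) ((2 ^ L : ℕ) : ℤ)).relIndex
      (AddSubgroup.closure (↑s : Set (galH1Torsion (W.baseChange K) ((2 ^ L : ℕ) : ℤ))) ⊓
        AddSubgroup.torsionBy (galH1Torsion (W.baseChange K) ((2 ^ L : ℕ) : ℤ)) (2 : ℤ)) ∣ 2 := by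
  have hle : AddSubgroup.closure (↑s : Set (galH1Torsion (W.baseChange K) ((2 ^ L : ℕ) : ℤ))) ≤ R :=
    (AddSubgroup.closure_le R).mpr hs
  exact relIndex_iInf_torsionLocalKer_inf_torsionBy_two_dvd_two_of_frob_smul_ne W hK hτ hL hKol hidx hfrob hε _ fun c hc ↦ hR c (hle hc)

/-- **`hK` on the KS clause's subgroup `⟨u⟩ ⊔ ⟨x⟩`** (`u` = the given SELMER `ε`-eigenclasses, `x` = the seed class) at a regular Zhang–Kolyvagin prime:
`(⨅_{v∋ℓ} torsionLocalKer_v).relIndex ((closure (range u) ⊔ zmultiples x) ⊓ H¹[2]) ∣ 2` (p723289's `…_closure_sup_zmultiples_dvd_two`, regular).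
[cite: McCallumLMS1991, §5 Prop. 5.2 (proof)] -/
theorem relIndex_iInf_torsionLocalKer_closure_sup_zmultiples_dvd_two_of_frob_smul_ne [W.IsGloballyMinimal]
    (hK : IsImaginaryQuadratic K) {τ : K ≃ₐ[ℚ] K} (hτ : τ ≠ 1) {L : ℕ} (hL : 1 ≤ L) {ℓ : ℕ}
    (hKol : Zhang2014.IsKolyvaginPrime (W.conductorNorm ℤ) W K 2 ℓ) (hidx : L ≤ Zhang2014.kolyvaginIndex W 2 ℓ)
    (hfrob : ∃ (v : HeightOneSpectrum (𝓞 ℚ)) (𝔓 : Ideal (absIntegers (𝓞 ℚ) ℚ)) (h : absoluteGaloisGroup ℚ),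
      (ℓ : 𝓞 ℚ) ∈ v.asIdeal ∧ 𝔓 ∈ v.primesAbove ∧ IsArithFrobAt (𝓞 ℚ) h 𝔓 ∧ ∃ u : geomTorsion W 2, h • u ≠ u)
    {ε : ℤ} (hε : ε = 1 ∨ ε = -1) {i : ℕ} (u : Fin i → galH1Torsion (W.baseChange K) ((2 ^ L : ℕ) : ℤ))
    (hu : ∀ j, u j ∈ selmerGroup (W.baseChange K) ((2 ^ L : ℕ) : ℤ) ∧ conjAct W τ ((2 ^ L : ℕ) : ℤ) (u j) = ε • u j)
    (x : galH1Torsion (W.baseChange K) ((2 ^ L : ℕ) : ℤ))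
    (hx : x ∈ selmerGroup (W.baseChange K) ((2 ^ L : ℕ) : ℤ) ∧ conjAct W τ ((2 ^ L : ℕ) : ℤ) x = ε • x) :
    (⨅ (v : HeightOneSpectrum (𝓞 K)) (_ : (ℓ : 𝓞 K) ∈ v.asIdeal),
        (W.baseChange K).torsionLocalKer (v.adicCompletion K) ((2 ^ L : ℕ) : ℤ)).relIndex
      ((AddSubgroup.closure (Set.range u) ⊔ AddSubgroup.zmultiples x) ⊓
        AddSubgroup.torsionBy (galH1Torsion (W.baseChange K) ((2 ^ L : ℕ) : ℤ)) (2 : ℤ)) ∣ 2 := by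
  have hgen : ∀ t ∈ Set.range u ∪ {x},
      t ∈ selmerGroup (W.baseChange K) ((2 ^ L : ℕ) : ℤ) ∧ conjAct W τ ((2 ^ L : ℕ) : ℤ) t = ε • t := by
    rintro t (⟨j, rfl⟩ | ht)
    · exact hu j
    · rw [Set.mem_singleton_iff.mp ht]; exact hx
  have hC : AddSubgroup.closure (Set.range u) ⊔ AddSubgroup.zmultiples x = AddSubgroup.closure (Set.range u ∪ {x}) := by
    rw [AddSubgroup.closure_union, AddSubgroup.zmultiples_eq_closure]
  rw [hC]
  exact relIndex_iInf_torsionLocalKer_inf_torsionBy_two_dvd_two_of_frob_smul_ne W hK hτ hL hKol hidx hfrob hε _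
    (forall_mem_closure_selmer_and_conjAct_eq W τ _ ε hgen)

/-! ## §3 Consistency on `Δ < 0`: Gross's (3.2) at level `2` already moves a `2`-torsion point -/

/-- **The regular socket subsumes the `Δ < 0` one, WITHOUT the surjectivity hypothesis of p727553's `hK_socket_of_frobEqFrobInfty_two`**: on
`Δ < 0`, for `G ℓ := FrobEqFrobInfty W K 2 ℓ ∧ G' ℓ` (the drops' `adm`, any `G'`) the Frobenius of (3.2) moves a `2`-torsion point
(`GenusKolySign.exists_twoTorsion_frob_smul_ne_of_frobEqFrobInfty_of_Δ_neg`: complex conjugation is a transposition on `E[2]` when `Δ < 0`), so §2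
applies — no lift of (3.2) from level `2` to `2^L` (hence no `ρ_{E,2^L}` onto) is needed. [cite: GrossLMS1991, §3 (3.2)–(3.3)]
[cite: McCallumLMS1991, §5 proof of Prop. 5.2] [cite: SilvermanAEC2009, III.1] -/
theorem hK_socket_of_frobEqFrobInfty_two_of_Δ_neg [W.IsGloballyMinimal] (hΔ : W.Δ < 0) (hK : IsImaginaryQuadratic K)
    {τ : K ≃ₐ[ℚ] K} (hτ : τ ≠ 1) {L : ℕ} (hL : 1 ≤ L) (r : ℕ) (G' : ℕ → Prop) :
    ∀ ℓ : ℕ, (Zhang2014.IsKolyvaginPrime (W.conductorNorm ℤ) W K 2 ℓ ∧ L ≤ Zhang2014.kolyvaginIndex W 2 ℓ) ∧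
        (FrobEqFrobInfty W K 2 ℓ ∧ G' ℓ) →
      ∀ C : AddSubgroup (galH1Torsion (W.baseChange K) ((2 ^ L : ℕ) : ℤ)),
      (∀ c ∈ C, c ∈ selmerGroup (W.baseChange K) ((2 ^ L : ℕ) : ℤ) ∧
        conjAct W τ ((2 ^ L : ℕ) : ℤ) c = (-W.rootNumber * (-1) ^ r) • c) →
      (⨅ (v : HeightOneSpectrum (𝓞 K)) (_ : ((ℓ : ℕ) : 𝓞 K) ∈ v.asIdeal),
          (W.baseChange K).torsionLocalKer (v.adicCompletion K) ((2 ^ L : ℕ) : ℤ)).relIndex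
        (C ⊓ AddSubgroup.torsionBy (galH1Torsion (W.baseChange K) ((2 ^ L : ℕ) : ℤ)) (2 : ℤ)) ∣ 2 :=
  hK_socket_of_frob_smul_ne W hK hτ hL r _ fun _ _ _ hGℓ ↦ by
    obtain ⟨v, 𝔓, h, ⟨hv, h𝔓, hh⟩, u, hu⟩ := exists_twoTorsion_frob_smul_ne_of_frobEqFrobInfty_of_Δ_neg W hΔ hGℓ.1
    exact ⟨v, 𝔓, h, hv, h𝔓, hh, u, hu⟩

end Summit.BirchSwinnertonDyer.BirchSwinnertonDyer.Theorems.GenusExact.PlusDescent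

end
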